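import Literature.MathematicalPhysics.QuantumFieldTheory.Balaban1983to89.Node00.ShearedAveragingRecordPureGauge
import Literature.MathematicalPhysics.QuantumFieldTheory.Balaban1983to89.Node00.LinearisedAveragingInfinitesimalGauge
import Literature.MathematicalPhysics.QuantumFieldTheory.Balaban1983to89.LatticeFieldCalculus

/-!
# NODE 00 — THE SHEARED AVERAGE OF RECORD IS MATCHED ON PURE GAUGES: `lin₁𝒜_j(∂φ) = ∂^{(j)}(Q′ʲφ)`
# (BRIDGE-92-B, road R4 item «file 2», instalment (f2-2): the pure-gauge linearisation of n07-w6's record hinge `𝒜_j(1^g) = 1^{R̄ʲg}`)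

Cell `pub-ymgap`, width seat `pub-ymgap-dag-n07-w1` generation 5 (DAG node N07 = [15] = [Balaban1985Variational]; OFFER-A″ INBOX l.31440,
lane owner dag-n07-e g20 «YES» l.31567, INTENT-2 l.31844).  NEW leaf, THEOREMS ONLY, `--kind proof --supports stmt-QuantumFields-20542` (K1⁷), count-neutral.
CONSUMED BY NAME, nothing modified: n07-w6's `Node00.ShearedAveragingRecord` ∕ `…RecordPureGauge` (`loopAvgBlockOp`, `loopAvgBlockOp_eq`, `loopAvgBlockOp_one`,
`expMeanLogSU_E_one'`, `gaugeAvgIter_loopAvgBlockOp_one`, ★ `shearedAvgIter_avOfRecord_pureGauge`), n07-e's `Node00.ShearedAveragingFlat` (`gaugeAvgF`, `gaugeAvgIter`,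
`shearedAvgIter`), lit-balaban's `LatticeFieldCalculus` (`siteAvg` (1.13), `siteAvgIter` (1.20) = print's `Q′`, `Q′ʲ`; `Site.blockOf_blockSite`) and `BIJ85GaugeFunction5113`
(`siteAvgIter_smul`), `BlockAveragingEMLAnalyticMean` (`hasFDerivAt_eml_one`, `coe_expMeanLogSU_E_eq_eml`), `B7TransferAnalyticMean.meanCLM`, 35b `Node00.AveragingSmooth`
(`eml_comp_equiv`), this seat's `Node00.LinearisedAveragingInfinitesimalGauge` (`hasDerivAt_coe_expSU_smul`) and `Node00.LinearisedAveragingShear` (`star_siteDeriv_of_one`),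
`Node00.WilsonActionSecondVariation` (`coe_inv_SU`, `star_coe_lieSU`).

THE PRINT.  [Balaban1985Averaging] (78)–(80) p. 30 (the block averages `R̄ʲu` of a gauge function, base point factored), (85)–(88) p. 31 («a new averaging operation …
acting on a configuration `U₁`» — the SHEARED average), (92) p. 32 (its linearisation); [Balaban1984PropagatorsI] (1.13) p. 19, (1.20) p. 20 (`Q′`, `Q′ʲ`, and `Q∂ = ∂Q′`);
[Balaban1984PropagatorsII] (2.7)∕(2.10) pp. 224–225 (`N(Q′)`: the gauge functions invisible to the constraints); [Balaban1985Variational] (44) p. 285, (152)–(154) p. 301.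

WHY (road bookkeeping, dag-n07-e g20 I.30615 ∕ I.31567).  On road R0′ the record's UNsheared `j`-fold average linearises on a pure gauge to the coarse gradient of the
CENTRE VALUES, `Q_j(1)(∂φ) = ∂^{(j)}(φ∘embIter j)` (`Node00.qLin_one_infGauge`, k0-s1-w1's `dIterL_one_grad`) — whence the unmatched lattice lemmas (P)∕(P′)∕(P)_D at the
record.  On road R4 the constraint map is the SHEARED average `𝒜_j` of (88); n07-w6's record hinge `shearedAvgIter_avOfRecord_pureGauge` says `𝒜_j(1^g) = 1^{R̄ʲg}` for EVERY
fine gauge function `g`; differentiating along `g_t = exp(t·φ)` gives THIS file's row: `lin₁𝒜_j(∂φ) = ∂^{(j)}(Q′ʲφ)` — the shear converts centre values into BLOCK MEANS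
exactly at first order, i.e. print's (1.20) `Q∂ = ∂Q′` holds for `lin₁𝒜_j`, so the gauge functions it does not see are print's `N(Q′)` and the Landau∕`R` bookkeeping of [B6]
Sect. A is MATCHED by construction (n07-w7's `flat_kernel_curlShift_iff` side untouched).  ROAD-NEUTRAL: the road word is the plan's.

CONTENTS (`M = M_N(ℂ)`; `𝓔 = loopAvgBlockOp expMeanLogSU` the (78) block operation of record; site fields matrix-valued, `Q′ = siteAvg`, `Q′ʲ = siteAvgIter j` as real-linear maps
on `Site → M`).
* §1 `coe_loopAvgBlockOp_eq_eml_of_small` (on the guard `𝓔_y{f}` IS the unguarded `eml` of the block family) · ★ `hasDerivAt_loopAvgBlockOp_one` — for a family of site unitaries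
  `f t` through `1` with matrix velocities `ψ`: `d∕dt ↑𝓔_y{f t}|₀ = (Q′ψ)(y)` (standing range `i + 1 ≤ m + K`; `hasFDerivAt_eml_one` = the arithmetic mean; the guard holds
  eventually along the family by continuity at `t = 0`) · `siteAvg_const_fun` · ★ `hasDerivAt_gaugeAvgF_one` — `d∕dt ↑(R̄ f_t)(y)|₀ = (Q′ψ)(y)` (the base-point factor `ψ(emb y)`
  cancels against `Q′(ψ − ψ(emb y))`) · `star_siteAvg` ∕ `star_siteAvgIter` · ★★ `hasDerivAt_gaugeAvgIter_one` — `d∕dt ↑(R̄ʲ f_t)(y)|₀ = (Q′ʲψ)(y)` (`j ≤ m + K`).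
* §2 ★★★ `hasDerivAt_shearedAvgIter_avOfRecord_pureGauge` — AT THE RECORD, every `φ : Site → 𝔰𝔲(N)`, every `j ≤ m + K`, every level-`j` bond `c`:
  `d∕dt ↑(𝒜_j(1^{exp(tφ)})(c))|₀ = (Q′ʲΦ)(c₋) − (Q′ʲΦ)(c₊)`, `Φ = ↑∘φ` — «`lin₁𝒜_j(∂φ) = ∂^{(j)}(Q′ʲφ)`» in print's orientation `gaugeAct u U b = u(b₋)·U(b)·u(b₊)⁻¹`;
  `shearedAvgIter_linearised_pureGauge_eq_zero_iff` (on a bond set: the velocity vanishes ⇔ `Q′ʲΦ(c₋) = Q′ʲΦ(c₊)` — the `N(Q′)` shape of [B6] (2.7)∕(2.10)).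
NOT HERE: `lin₁𝒜_j` on a general direction `X` ((f2-1)∕(f2-3): the `σ_j` recursion), the `Q♯`∕`H♯` sizes, (f2-4) — dag-n07-e's file 2 proper.

HONEST FRAMING: calculus bookkeeping — one chain rule through `exp[mean log]` at the identity applied to a landed group identity; NO estimate of [3]∕[15]∕[6]; road-neutral;
BRIDGE-92-B stays GAP-STATED (lane's word); N07 NOT discharged; K1⁷∕K0⁷ NOT closed; counts unmoved (typed 28∕28 · discharged 5∕27); one finite 𝕋⁴ programme at fixed ε —
NOT continuum ∕ ℝ⁴ ∕ OS ∕ mass gap ∕ Clay (R4-the-rung closes the conditional finite-𝕋⁴ rung `BalabanLadder.UV` only).  No `sorry`, no `def`, no `instance`, no `notation`.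
-/

noncomputable section

namespace Literature.MathematicalPhysics.QuantumFieldTheory.Balaban1983to89.Node00

open Filter Topology
open T4Continuum BlockAveraging B15DeterminingSets
open ExpMeanLog (expMeanLogSU deltaSU deltaSU_pos eml)
open T4AdjointCovarianceUnitary (lieSU expSU coe_expSU)
open LatticeFieldCalculus (siteAvg siteAvgIter)
open GaugeField (gaugeAct)
open scoped Matrix.Norms.L2Operator

/-! ## §1  The linearisation of the (78) block operation and of the block averages `R̄ʲ` of a gauge function, at the identity -/

section BlockOp

variable {P : Params} {N : ℕ} [NeZero N]

/-- **ON THE GUARD THE BLOCK OPERATION OF RECORD IS THE UNGUARDED `exp[mean log]` OF THE BLOCK FAMILY**: in the standing range `i + 1 ≤ m + K`, if every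
`‖↑f(x) − 1‖ < δ_N` on the block `B(y)`, then `↑𝓔_y{f} = eml{↑f(blockSite y r)}_{r ∈ {0,…,L−1}^d}`. [cite: Balaban1987RG1, (0.4) p.253; Balaban1985Averaging, (78) p.30] -/
theorem coe_loopAvgBlockOp_eq_eml_of_small {i : ℕ} (hi : i + 1 ≤ P.m + P.K) (y : Site P (i + 1)) (f : Site P i → SU N)
    (hsm : ∀ r : Fin P.d → Fin P.L, ‖((f (Site.blockSite y r) : SU N) : Matrix (Fin N) (Fin N) ℂ) - 1‖ < deltaSU (Fin N)) :
    ((loopAvgBlockOp expMeanLogSU i y f : SU N) : Matrix (Fin N) (Fin N) ℂ) =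
      eml (fun r : Fin P.d → Fin P.L => ((f (Site.blockSite y r) : SU N) : Matrix (Fin N) (Fin N) ℂ)) := by
  rw [loopAvgBlockOp_eq _ hi]
  show (((expMeanLogSU (n := Fin N)).E ((fun r : Fin P.d → Fin P.L => f (Site.blockSite y r)) ∘ (LoopAverage.enum (Fin P.d → Fin P.L)).symm) : SU N) :
      Matrix (Fin N) (Fin N) ℂ) = _
  have hsmall : ∀ k, dist1 (((fun r : Fin P.d → Fin P.L => f (Site.blockSite y r)) ∘ (LoopAverage.enum (Fin P.d → Fin P.L)).symm) k) < deltaSU (Fin N) :=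
    fun k => hsm _
  rw [BlockAveragingEMLAnalyticMean.coe_expMeanLogSU_E_eq_eml _ hsmall]
  exact eml_comp_equiv (fun r : Fin P.d → Fin P.L => ((f (Site.blockSite y r) : SU N) : Matrix (Fin N) (Fin N) ℂ)) (LoopAverage.enum (Fin P.d → Fin P.L)).symm

omit [NeZero N] in
/-- The arithmetic mean of the block family, as printed: `(card {0,…,L−1}^d)⁻¹·Σ_r ψ(blockSite y r) = (Q′ψ)(y)`. [cite: Balaban1984PropagatorsI, (1.13) p.19] -/
theorem meanCLM_blockSite_eq_siteAvg {i : ℕ} (ψ : Site P i → Matrix (Fin N) (Fin N) ℂ) (y : Site P (i + 1)) :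
    ((B7TransferAnalyticMean.meanCLM (Fin P.d → Fin P.L) (Matrix (Fin N) (Fin N) ℂ)).restrictScalars ℝ)
        (fun r : Fin P.d → Fin P.L => ψ (Site.blockSite y r)) = siteAvg ψ y := by
  rw [ContinuousLinearMap.coe_restrictScalars', B7TransferAnalyticMean.meanCLM_apply]
  unfold siteAvg
  rw [Fintype.card_fun, Fintype.card_fin, Fintype.card_fin, ← Complex.coe_smul]
  push_cast
  rfl

/-- ★ **THE LINEARISATION OF THE (78) BLOCK OPERATION AT THE IDENTITY IS THE BLOCK MEAN `Q′`**: for a family `f t` of site unitaries through `1` (`f 0 = 1`) whose matrices have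
velocities `ψ` at `t = 0`, `t ↦ ↑𝓔_y{f t}` has derivative `(Q′ψ)(y)` at `0` (standing range `i + 1 ≤ m + K`).  The guard of the total extension holds for `t` near `0` by
continuity, where `𝓔` is the analytic `exp[mean log]` with derivative the arithmetic mean at the identity tuple. [cite: Balaban1985Averaging, (78) p.30, (92) p.32; Balaban1987RG1, (0.8) p.253] -/
theorem hasDerivAt_loopAvgBlockOp_one {i : ℕ} (hi : i + 1 ≤ P.m + P.K) (y : Site P (i + 1)) {f : ℝ → Site P i → SU N}
    {ψ : Site P i → Matrix (Fin N) (Fin N) ℂ} (hf : ∀ x, HasDerivAt (fun t : ℝ => ((f t x : SU N) : Matrix (Fin N) (Fin N) ℂ)) (ψ x) 0)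
    (h1 : ∀ x, f 0 x = 1) :
    HasDerivAt (fun t : ℝ => ((loopAvgBlockOp expMeanLogSU i y (f t) : SU N) : Matrix (Fin N) (Fin N) ℂ)) (siteAvg ψ y) 0 := by
  have hW : HasDerivAt (fun (t : ℝ) (r : Fin P.d → Fin P.L) => ((f t (Site.blockSite y r) : SU N) : Matrix (Fin N) (Fin N) ℂ))
      (fun r : Fin P.d → Fin P.L => ψ (Site.blockSite y r)) 0 :=
    hasDerivAt_pi.2 fun r => hf _
  have hW0 : (1 : (Fin P.d → Fin P.L) → Matrix (Fin N) (Fin N) ℂ) =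
      fun r : Fin P.d → Fin P.L => ((f 0 (Site.blockSite y r) : SU N) : Matrix (Fin N) (Fin N) ℂ) := by
    funext r
    rw [h1, Pi.one_apply, OneMemClass.coe_one]
  have heml : HasFDerivAt (eml : ((Fin P.d → Fin P.L) → Matrix (Fin N) (Fin N) ℂ) → Matrix (Fin N) (Fin N) ℂ)
      ((B7TransferAnalyticMean.meanCLM (Fin P.d → Fin P.L) (Matrix (Fin N) (Fin N) ℂ)).restrictScalars ℝ) 1 :=
    (BlockAveragingEMLAnalyticMean.hasFDerivAt_eml_one).restrictScalars ℝ
  have hcomp := heml.comp_hasDerivAt_of_eq (0 : ℝ) hW hW0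
  rw [meanCLM_blockSite_eq_siteAvg] at hcomp
  have hev : ∀ᶠ t in 𝓝 (0 : ℝ), ((loopAvgBlockOp expMeanLogSU i y (f t) : SU N) : Matrix (Fin N) (Fin N) ℂ) =
      eml (fun r : Fin P.d → Fin P.L => ((f t (Site.blockSite y r) : SU N) : Matrix (Fin N) (Fin N) ℂ)) := by
    have hct : ∀ r : Fin P.d → Fin P.L, ∀ᶠ t in 𝓝 (0 : ℝ),
        ‖((f t (Site.blockSite y r) : SU N) : Matrix (Fin N) (Fin N) ℂ) - 1‖ < deltaSU (Fin N) := by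
      intro r
      have hc : Tendsto (fun t : ℝ => ‖((f t (Site.blockSite y r) : SU N) : Matrix (Fin N) (Fin N) ℂ) - 1‖) (𝓝 0)
          (𝓝 ‖((f 0 (Site.blockSite y r) : SU N) : Matrix (Fin N) (Fin N) ℂ) - 1‖) :=
        (((hf _).continuousAt.sub continuousAt_const).norm).tendsto
      rw [h1, OneMemClass.coe_one, sub_self, norm_zero] at hc
      exact hc.eventually_lt_const deltaSU_pos
    exact (Filter.eventually_all.2 hct).mono fun t ht => coe_loopAvgBlockOp_eq_eml_of_small hi y (f t) ht
  exact hcomp.congr_of_eventuallyEq hev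

omit [NeZero N] in
/-- `Q′` of a constant site field is that constant (`(L^d)⁻¹·Σ_r c = c`). [cite: Balaban1984PropagatorsI, (1.13) p.19 (bookkeeping)] -/
theorem siteAvg_const_fun {i : ℕ} (a : Matrix (Fin N) (Fin N) ℂ) (y : Site P (i + 1)) : siteAvg (fun _ : Site P i => a) y = a := by
  unfold siteAvg
  rw [Finset.sum_const, Finset.card_univ, Fintype.card_fun, Fintype.card_fin, Fintype.card_fin, ← Nat.cast_smul_eq_nsmul ℝ, smul_smul]
  have hL : ((P.L : ℝ) ^ P.d) ≠ 0 := pow_ne_zero _ (Nat.cast_ne_zero.mpr (ne_of_gt P.L_pos))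
  rw [Nat.cast_pow, inv_mul_cancel₀ hL, one_smul]

/-- ★ **THE LINEARISATION OF THE ONE-STEP BLOCK AVERAGE (78) OF A GAUGE FUNCTION AT THE IDENTITY IS THE BLOCK MEAN**: `d∕dt ↑(R̄ f_t)(y)|₀ = (Q′ψ)(y)` — the base-point
factor contributes `ψ(emb y)`, the inner family `f_t(emb y)⁻¹·f_t(x)` has velocity `ψ(x) − ψ(emb y)`, whose block mean is `(Q′ψ)(y) − ψ(emb y)`.
[cite: Balaban1985Averaging, (78) p.30, (92) p.32; Balaban1984PropagatorsI, (1.13) p.19] -/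
theorem hasDerivAt_gaugeAvgF_one {i : ℕ} (hi : i + 1 ≤ P.m + P.K) {f : ℝ → GaugeTransf P i (SU N)} {ψ : Site P i → Matrix (Fin N) (Fin N) ℂ}
    (hf : ∀ x, HasDerivAt (fun t : ℝ => ((f t x : SU N) : Matrix (Fin N) (Fin N) ℂ)) (ψ x) 0) (h1 : ∀ x, f 0 x = 1) (y : Site P (i + 1)) :
    HasDerivAt (fun t : ℝ => ((gaugeAvgF (loopAvgBlockOp expMeanLogSU i) (f t) y : SU N) : Matrix (Fin N) (Fin N) ℂ)) (siteAvg ψ y) 0 := by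
  -- the inner family `x ↦ f_t(emb y)⁻¹ · f_t(x)` and its velocity
  have hg : ∀ x, HasDerivAt (fun t : ℝ => (((f t (emb y))⁻¹ * f t x : SU N) : Matrix (Fin N) (Fin N) ℂ)) (ψ x - ψ (emb y)) 0 := by
    intro x
    have hfun : (fun t : ℝ => (((f t (emb y))⁻¹ * f t x : SU N) : Matrix (Fin N) (Fin N) ℂ)) =
        fun t : ℝ => star ((f t (emb y) : SU N) : Matrix (Fin N) (Fin N) ℂ) * ((f t x : SU N) : Matrix (Fin N) (Fin N) ℂ) := by
      funext t
      rw [Submonoid.coe_mul, coe_inv_SU]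
    rw [hfun]
    refine (((hf (emb y)).star).mul (hf x)).congr_deriv ?_
    rw [h1, h1, OneMemClass.coe_one, star_one, one_mul, mul_one, star_siteDeriv_of_one (hf (emb y)) (h1 (emb y))]
    abel
  have hg1 : ∀ x, ((f 0 (emb y))⁻¹ * f 0 x : SU N) = 1 := by
    intro x
    rw [h1, h1, inv_one, one_mul]
  have hE := hasDerivAt_loopAvgBlockOp_one hi y (f := fun t x => (f t (emb y))⁻¹ * f t x) hg hg1
  have hE0 : loopAvgBlockOp expMeanLogSU i y (fun x => (f 0 (emb y))⁻¹ * f 0 x) = (1 : SU N) := by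
    have hfam : (fun x => (f 0 (emb y))⁻¹ * f 0 x) = fun _ : Site P i => (1 : SU N) := funext hg1
    rw [hfam]
    exact loopAvgBlockOp_one _ (expMeanLogSU_E_one' N) i y
  have hprod := (hf (emb y)).mul hE
  have hfun2 : (fun t : ℝ => ((gaugeAvgF (loopAvgBlockOp expMeanLogSU i) (f t) y : SU N) : Matrix (Fin N) (Fin N) ℂ)) =
      fun t : ℝ => ((f t (emb y) : SU N) : Matrix (Fin N) (Fin N) ℂ) *
        ((loopAvgBlockOp expMeanLogSU i y (fun x => (f t (emb y))⁻¹ * f t x) : SU N) : Matrix (Fin N) (Fin N) ℂ) := by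
    funext t
    unfold gaugeAvgF
    rw [Submonoid.coe_mul]
  rw [hfun2]
  refine hprod.congr_deriv ?_
  rw [hE0, h1, OneMemClass.coe_one, mul_one, one_mul]
  have hsub : (fun x => ψ x - ψ (emb y)) = ψ - fun _ : Site P i => ψ (emb y) := rfl
  rw [hsub, BalabanImbrieJaffe1984to88.BIJ85GaugeFunction5113.siteAvg_sub, Pi.sub_apply, siteAvg_const_fun]
  abel

omit [NeZero N] in
/-- `Q′` commutes with `star` (its weights are real). [cite: Balaban1984PropagatorsI, (1.13) p.19 (bookkeeping)] -/
theorem star_siteAvg {i : ℕ} (ψ : Site P i → Matrix (Fin N) (Fin N) ℂ) (y : Site P (i + 1)) :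
    star (siteAvg ψ y) = siteAvg (fun x => star (ψ x)) y := by
  unfold siteAvg
  rw [star_smul, star_sum, star_trivial]

omit [NeZero N] in
/-- `Q′ʲ` commutes with `star`. [cite: Balaban1984PropagatorsI, (1.20) p.20 (bookkeeping)] -/
theorem star_siteAvgIter (ψ : Site P 0 → Matrix (Fin N) (Fin N) ℂ) :
    ∀ (j : ℕ) (y : Site P j), star (siteAvgIter j ψ y) = siteAvgIter j (fun x => star (ψ x)) y
  | 0, _ => rfl
  | j + 1, y => by
    show star (siteAvg (siteAvgIter j ψ) y) = siteAvg (siteAvgIter j fun x => star (ψ x)) y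
    rw [star_siteAvg]
    congr 1
    funext x
    exact star_siteAvgIter ψ j x

/-- ★★ **THE LINEARISATION OF THE `j`-FOLD BLOCK AVERAGE (79)–(80) OF A GAUGE FUNCTION AT THE IDENTITY IS `Q′ʲ`**: for a family `f t` of fine gauge functions through `1` with matrix
velocities `ψ`, `d∕dt ↑(R̄ʲ f_t)(y)|₀ = (Q′ʲψ)(y)` for every `j ≤ m + K` (induction on §1's one-step lemma; n07-w6's `R̄ʲ1 = 1` supplies the base point at each level).
[cite: Balaban1985Averaging, (79)-(80) p.30, (92) p.32; Balaban1984PropagatorsI, (1.20) p.20] -/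
theorem hasDerivAt_gaugeAvgIter_one {f : ℝ → GaugeTransf P 0 (SU N)} {ψ : Site P 0 → Matrix (Fin N) (Fin N) ℂ}
    (hf : ∀ x, HasDerivAt (fun t : ℝ => ((f t x : SU N) : Matrix (Fin N) (Fin N) ℂ)) (ψ x) 0) (h1 : ∀ x, f 0 x = 1) :
    ∀ {j : ℕ}, j ≤ P.m + P.K → ∀ y : Site P j,
      HasDerivAt (fun t : ℝ => ((gaugeAvgIter (loopAvgBlockOp expMeanLogSU) (f t) j y : SU N) : Matrix (Fin N) (Fin N) ℂ)) (siteAvgIter j ψ y) 0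
  | 0, _, y => hf y
  | j + 1, hj, y => by
    have ih : ∀ x : Site P j, HasDerivAt (fun t : ℝ => ((gaugeAvgIter (loopAvgBlockOp expMeanLogSU) (f t) j x : SU N) : Matrix (Fin N) (Fin N) ℂ))
        (siteAvgIter j ψ x) 0 := fun x => hasDerivAt_gaugeAvgIter_one hf h1 (Nat.le_of_succ_le hj) x
    have h1j : ∀ x : Site P j, gaugeAvgIter (loopAvgBlockOp expMeanLogSU) (f 0) j x = 1 := by
      intro x
      have hf0 : f 0 = fun _ => 1 := funext h1
      rw [hf0, gaugeAvgIter_loopAvgBlockOp_one _ (expMeanLogSU_E_one' N) j]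
    exact hasDerivAt_gaugeAvgF_one hj (f := fun t => gaugeAvgIter (loopAvgBlockOp expMeanLogSU) (f t) j) ih h1j y

end BlockOp

/-! ## §2  AT THE RECORD: `lin₁𝒜_j(∂φ) = ∂^{(j)}(Q′ʲφ)` -/

section Record

variable (F : T4Family) (N : ℕ) [NeZero N]

/-- ★★★ **THE SHEARED AVERAGE OF RECORD IS MATCHED ON PURE GAUGES — `lin₁𝒜_j(∂φ) = ∂^{(j)}(Q′ʲφ)`**: for the averaging of record ((0.4), `exp[mean log]` on `SU(N)`), the
contour datum of record and the `exp[mean log]` block operation, every `φ : Site → 𝔰𝔲(N)`, every `j ≤ m + K` and every level-`j` bond `c`, the sheared `j`-fold average of the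
pure gauge `1^{g_t}`, `g_t = exp(t·φ)`, has `t`-derivative at `0` equal to `(Q′ʲΦ)(c₋) − (Q′ʲΦ)(c₊)`, `Φ = ↑∘φ` — the coarse pure gauge of the `j`-fold BLOCK MEANS of `φ` (orientation
`gaugeAct u U b = u(b₋)·U(b)·u(b₊)⁻¹`).  Differentiate n07-w6's hinge `𝒜_j(1^g) = 1^{R̄ʲg}` with §1.  Contrast: the UNsheared record average gives the CENTRE VALUES,
`Φ(embIter j c₋) − Φ(embIter j c₊)` (`Node00.dIterL_one_apply_infGauge`). [cite: Balaban1985Averaging, (88) p.31, (92) p.32, (79)-(80) p.30; Balaban1984PropagatorsI, (1.20) p.20; Balaban1985Variational, (154) p.301] -/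
theorem hasDerivAt_shearedAvgIter_avOfRecord_pureGauge (K : ℕ) {j : ℕ} (hj : j ≤ (F.P K).m + (F.P K).K) (φ : Site (F.P K) 0 → lieSU (Fin N)) (c : PBond (F.P K) j) :
    HasDerivAt (fun t : ℝ => ((shearedAvgIter (avOfRecord F N K) (contourOfRecord F N K) (loopAvgBlockOp expMeanLogSU)
        (gaugeAct (fun x => expSU (t • φ x)) (1 : GaugeField (F.P K) 0 (SU N))) j c : SU N) : Matrix (Fin N) (Fin N) ℂ))
      (siteAvgIter j (fun x => (φ x : Matrix (Fin N) (Fin N) ℂ)) c.src - siteAvgIter j (fun x => (φ x : Matrix (Fin N) (Fin N) ℂ)) c.tgt) 0 := by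
  have hfun : (fun t : ℝ => ((shearedAvgIter (avOfRecord F N K) (contourOfRecord F N K) (loopAvgBlockOp expMeanLogSU)
        (gaugeAct (fun x => expSU (t • φ x)) (1 : GaugeField (F.P K) 0 (SU N))) j c : SU N) : Matrix (Fin N) (Fin N) ℂ)) =
      fun t : ℝ => ((gaugeAvgIter (loopAvgBlockOp expMeanLogSU) (fun x => expSU (t • φ x)) j c.src : SU N) : Matrix (Fin N) (Fin N) ℂ) *
        star ((gaugeAvgIter (loopAvgBlockOp expMeanLogSU) (fun x => expSU (t • φ x)) j c.tgt : SU N) : Matrix (Fin N) (Fin N) ℂ) := by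
    funext t
    rw [shearedAvgIter_avOfRecord_pureGauge F N K (fun x => expSU (t • φ x)) hj]
    show (((gaugeAvgIter (loopAvgBlockOp expMeanLogSU) (fun x => expSU (t • φ x)) j c.src * 1 *
        (gaugeAvgIter (loopAvgBlockOp expMeanLogSU) (fun x => expSU (t • φ x)) j c.tgt)⁻¹ : SU N)) : Matrix (Fin N) (Fin N) ℂ) = _
    rw [mul_one, Submonoid.coe_mul, coe_inv_SU]
  rw [hfun]
  have hf : ∀ x : Site (F.P K) 0, HasDerivAt (fun t : ℝ => ((expSU (t • φ x) : SU N) : Matrix (Fin N) (Fin N) ℂ)) (φ x : Matrix (Fin N) (Fin N) ℂ) 0 :=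
    fun x => hasDerivAt_coe_expSU_smul (φ x)
  have h1 : ∀ x : Site (F.P K) 0, expSU ((0 : ℝ) • φ x) = 1 := fun x => by rw [zero_smul, expSU_zero]
  have h10 : ∀ y : Site (F.P K) j, gaugeAvgIter (loopAvgBlockOp expMeanLogSU) (fun x => expSU ((0 : ℝ) • φ x)) j y = 1 := by
    intro y
    have hf0 : (fun x : Site (F.P K) 0 => expSU ((0 : ℝ) • φ x)) = fun _ => 1 := funext h1
    rw [hf0, gaugeAvgIter_loopAvgBlockOp_one _ (expMeanLogSU_E_one' N) j]
  have hs := hasDerivAt_gaugeAvgIter_one (f := fun t x => expSU (t • φ x)) hf h1 hj c.src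
  have ht := (hasDerivAt_gaugeAvgIter_one (f := fun t x => expSU (t • φ x)) hf h1 hj c.tgt).star
  refine (hs.mul ht).congr_deriv ?_
  rw [h10, h10, OneMemClass.coe_one, star_one, mul_one, one_mul, star_siteAvgIter]
  have hskew : (fun x => star ((φ x : lieSU (Fin N)) : Matrix (Fin N) (Fin N) ℂ)) = (-1 : ℝ) • fun x => ((φ x : lieSU (Fin N)) : Matrix (Fin N) (Fin N) ℂ) := by
    funext x
    rw [Pi.smul_apply, star_coe_lieSU, neg_one_smul]
  rw [hskew, BalabanImbrieJaffe1984to88.BIJ85GaugeFunction5113.siteAvgIter_smul, Pi.smul_apply, neg_one_smul, sub_eq_add_neg]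

omit [NeZero N] in
/-- **THE `N(Q′)` SHAPE** ([B6] (2.7)∕(2.10)): on any set `S` of level-`j` bonds, the pure-gauge velocity of the sheared average of record vanishes on `S` iff the `j`-fold block
means of `φ` agree across every bond of `S` — the gauge functions invisible to `lin₁𝒜_j` at first order are exactly those with `Q′ʲφ` locally constant (print's matched gauge space),
not those constant on the block CENTRES. [cite: Balaban1984PropagatorsII, (2.7) p.224, (2.10) p.225; Balaban1985Averaging, (92) p.32] -/
theorem shearedAvgIter_linearised_pureGauge_eq_zero_iff {K j : ℕ} (φ : Site (F.P K) 0 → lieSU (Fin N)) (S : Set (PBond (F.P K) j)) :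
    (∀ c ∈ S, siteAvgIter j (fun x => (φ x : Matrix (Fin N) (Fin N) ℂ)) c.src - siteAvgIter j (fun x => (φ x : Matrix (Fin N) (Fin N) ℂ)) c.tgt = 0) ↔
      ∀ c ∈ S, siteAvgIter j (fun x => (φ x : Matrix (Fin N) (Fin N) ℂ)) c.src = siteAvgIter j (fun x => (φ x : Matrix (Fin N) (Fin N) ℂ)) c.tgt := by
  simp only [sub_eq_zero]

end Record

end Literature.MathematicalPhysics.QuantumFieldTheory.Balaban1983to89.Node00
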